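import Literature.AlgebraicGeometry.Resolution.MacaulayficationPrincipalization
import Literature.AlgebraicGeometry.Resolution.AlterationsNormalizationReduction
import Literature.AlgebraicGeometry.Resolution.AlterationsResolution
import Literature.AlgebraicGeometry.Resolution.ComponentGluing
import Summits.ResolutionOfSingularities.ResolutionOfSingularities.Theorems.FrobeniusLadderFRationalModificationCmCartierHull
import Summits.ResolutionOfSingularities.ResolutionOfSingularities.Theorems.FrobeniusLadderFInjectiveMacaulayficationStubCmGlue
import Mathlib.AlgebraicGeometry.IdealSheaf.Functorial
import Mathlib.AlgebraicGeometry.FunctionField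
import HarnessLib

/-!
# Česnavičius's principalization corollary from Macaulayfication (crux `FrobeniusLadder.FRationalModification`,
line `birth` v3, stub `stub_principalizationOfMacaulayfication`)

The tree's named fact `CesnaviciusPrincipalization` (Česnavičius 2021, §1 Cor. (principalize), special case:
`X/k` integral separated finite type with Cohen–Macaulay stalks, `Z` with `Supp Z ≠ X`) FOLLOWS from
(i) blow-up principalization (`hB`: `Bl_Z X → X` proper birational, integral, `Z·𝒪` effective Cartier,
isomorphism off `Supp Z` — proved in tree from the blow-up API) and (ii) Macaulayfication in the sharp form
of Česnavičius 2021 Thm. 1.6 (`hM`: a proper birational integral Cohen–Macaulay model that is an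
ISOMORPHISM over every open all of whose stalks are Cohen–Macaulay), exactly as in loc. cit.: Macaulayfy
`W₀ = Bl_Z X`; the composite `W₁ → W₀ → X` is proper birational, `W₁` integral Cohen–Macaulay; the preimage
of `Z` is the pull-back of an effective Cartier divisor along a dominant morphism of integral schemes, hence
effective Cartier (`IsEffectiveCartier.comap_of_isDominant`); and over `X ∖ Supp Z` both maps are
isomorphisms (`W₀ ∖ π₀⁻¹ Supp Z ≅ X ∖ Supp Z` has Cohen–Macaulay stalks, transported along the stalk
isomorphisms, `CmCartierHull.isIso_stalkMap_of_isIso_morphismRestrict`,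
`FInjectiveMacaulayfication.cmDomain_of_ringEquiv`).
-/

-- single-problem summit: the doubled namespace component `ResolutionOfSingularities` is forced
set_option linter.dupNamespace false

noncomputable section

open CategoryTheory AlgebraicGeometry TopologicalSpace
open Literature.AlgebraicGeometry.Resolution

namespace Summit.ResolutionOfSingularities.ResolutionOfSingularities.Theorems.FRationalModification.PrincipalizationOfMacaulayfication

/-- **Česnavičius 2021, §1 Cor. (principalize) from Thm. 1.6**: blow-up principalization (`hB`) followed by a
Macaulayfication of the blow-up that is an isomorphism over the Cohen–Macaulay locus (`hM`) principalizes
any `Z` with `Supp Z ≠ X` on an integral Cohen–Macaulay `X/k` while keeping Cohen–Macaulayness — the tree's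
named fact `CesnaviciusPrincipalization`. [cite: Cesnavicius2021, §1 Corollary (principalize) after Thm. 1.6;
Thm. 5.3, Rem. 5.4] -/
theorem stub_principalizationOfMacaulayfication
    (hB : ∀ (Y : Scheme.{0}) [IsIntegral Y] [IsLocallyNoetherian Y] (Z : Y.IdealSheafData),
      Z.support ≠ ⊤ → ∃ (W : Scheme.{0}) (π : W ⟶ Y), IsProper π ∧ IsBirational π ∧ IsIntegral W ∧
        IsEffectiveCartier (Z.comap π) ∧ IsIso (π ∣_ Z.support.compl))
    (hM : ∀ (k : Type) [Field k] (X : Scheme.{0}) (f : X ⟶ Spec (.of k)),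
      IsSeparated f → LocallyOfFiniteType f → QuasiCompact f → IsIntegral X →
        ∃ (X₁ : Scheme.{0}) (π₁ : X₁ ⟶ X), IsProper π₁ ∧ IsBirational π₁ ∧ IsIntegral X₁ ∧
          (∀ x : X₁, ∀ d : ℕ, ringKrullDim (X₁.presheaf.stalk x) = d →
            ∀ s : Fin d → X₁.presheaf.stalk x, (Ideal.span (Set.range s)).radical.IsMaximal →
              RingTheory.Sequence.IsWeaklyRegular (X₁.presheaf.stalk x) (List.ofFn s)) ∧
          ∀ U : X.Opens, (∀ x : X, x ∈ U → ∀ d : ℕ, ringKrullDim (X.presheaf.stalk x) = d →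
            ∀ s : Fin d → X.presheaf.stalk x, (Ideal.span (Set.range s)).radical.IsMaximal →
              RingTheory.Sequence.IsWeaklyRegular (X.presheaf.stalk x) (List.ofFn s)) →
            IsIso (π₁ ∣_ U)) :
    CesnaviciusPrincipalization.{0} := by
  intro k _ X f hs hl hq hX hCM Z hZ
  haveI := hs; haveI := hl; haveI := hq; haveI := hX
  haveI : IsLocallyNoetherian X := LocallyOfFiniteType.isLocallyNoetherian f
  -- (1) blow-up principalization of `Z`
  obtain ⟨W₀, π₀, hπ₀, hbir₀, hW₀, hcart₀, hiso₀⟩ := hB X Z hZ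
  haveI := hπ₀; haveI := hW₀; haveI := hiso₀
  -- (2) Macaulayfy `W₀`, by an isomorphism over its Cohen–Macaulay locus
  obtain ⟨W₁, π₁, hπ₁, hbir₁, hW₁, hCM₁, hisoU⟩ :=
    hM k W₀ (π₀ ≫ f) inferInstance inferInstance inferInstance hW₀
  haveI := hπ₁; haveI := hW₁
  haveI : IsDominant π₁ := hbir₁.isDominant
  -- (3) the composite `W₁ → W₀ → X`
  refine ⟨W₁, π₁ ≫ π₀, inferInstance, IsBirational.comp hbir₁ hbir₀, hW₁, hCM₁, ?_, ?_⟩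
  · -- the preimage of `Z` is the pull-back of an effective Cartier divisor along a dominant morphism
    rw [Scheme.IdealSheafData.comap_comp]
    exact hcart₀.comap_of_isDominant π₁
  · -- over `X ∖ Supp Z`: `π₀` is an isomorphism there, so the stalks of `W₀` over it are
    -- Cohen–Macaulay (transport along the stalk isomorphisms) and `π₁` is an isomorphism over
    -- `π₀⁻¹(X ∖ Supp Z)`; compose.
    haveI : IsIso (π₁ ∣_ π₀ ⁻¹ᵁ Z.support.compl) := by
      refine hisoU (π₀ ⁻¹ᵁ Z.support.compl) fun x hx d hd t ht => ?_
      haveI : IsIso (π₀.stalkMap x) :=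
        CmCartierHull.isIso_stalkMap_of_isIso_morphismRestrict π₀ Z.support.compl x hx
      exact (FInjectiveMacaulayfication.cmDomain_of_ringEquiv
        (asIso (π₀.stalkMap x)).commRingCatIsoToRingEquiv ⟨inferInstance, hCM (π₀.base x)⟩).2
          d hd t ht
    rw [morphismRestrict_comp]
    exact IsIso.comp_isIso (f := π₁ ∣_ π₀ ⁻¹ᵁ Z.support.compl) (h := π₀ ∣_ Z.support.compl)

end Summit.ResolutionOfSingularities.ResolutionOfSingularities.Theorems.FRationalModification.PrincipalizationOfMacaulayfication

end
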